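import Summits.Ventures.PercRepro.K5MatroidDefs

/-!
# PercRepro — `M(K₅)`: union-find computes the rank, the sets with at least six edges (p9, gen 15; local draft)

`rkG X = rk X` on the edge sets with 6 … 10 edges (one kernel decision per size: the 1024-element traversal with the
rank computed on the matching sets only — one theorem for all 1024 sets exceeds the kernel's per-declaration budget).
Nothing here is about any window of S4.
-/

namespace PercRepro.K5Ladder

open Finset

set_option maxHeartbeats 4000000 in
/-- Union-find computes the matroid rank on the edge sets with `6` edges (`C(10,6)` kernel evaluations of both). -/
theorem rkG_eq_rk_6 : ∀ X : Finset (Fin 10), X.card = 6 → rkG X = rk X := by decide +kernel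

set_option maxHeartbeats 4000000 in
/-- Union-find computes the matroid rank on the edge sets with `7` edges (`C(10,7)` kernel evaluations of both). -/
theorem rkG_eq_rk_7 : ∀ X : Finset (Fin 10), X.card = 7 → rkG X = rk X := by decide +kernel

set_option maxHeartbeats 4000000 in
/-- Union-find computes the matroid rank on the edge sets with `8` edges (`C(10,8)` kernel evaluations of both). -/
theorem rkG_eq_rk_8 : ∀ X : Finset (Fin 10), X.card = 8 → rkG X = rk X := by decide +kernel

set_option maxHeartbeats 4000000 in
/-- Union-find computes the matroid rank on the edge sets with `9` edges (`C(10,9)` kernel evaluations of both). -/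
theorem rkG_eq_rk_9 : ∀ X : Finset (Fin 10), X.card = 9 → rkG X = rk X := by decide +kernel

set_option maxHeartbeats 4000000 in
/-- Union-find computes the matroid rank on the edge sets with `10` edges (`C(10,10)` kernel evaluations of both). -/
theorem rkG_eq_rk_10 : ∀ X : Finset (Fin 10), X.card = 10 → rkG X = rk X := by decide +kernel

end PercRepro.K5Ladder
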